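import Summits.ResolutionOfSingularities.ResolutionOfSingularities.Theorems.EquisingularLiftEquisingularLiftNatDirDictAdaptedFrame
import Mathlib.LinearAlgebra.Matrix.NonsingularInverse
import HarnessLib

/-!
# [OURS · L1 W4.5(b) · EL♮(3) · S6 (L) C2 · B1′, ring lemma] Any generating pair of an ideal with a quasi-regular
# generating pair is quasi-regular (local ring)

Crux chain w45b (cell `res-hironaka`), child EL♮(3) = stmt-ResolutionOfSingularities-20148; S6 (L) brick C2, sub-brick B1′
(`exists_affine_adaptedFrame`, res-type-027 g15's cut `B1prime-AdaptedFrame.sig.lean` ec2273d21c04e91d). This file is the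
ring-theoretic input: in a LOCAL ring `R`, if `J = (c'₀, c'₁) ⊆ 𝔪` with `c'` quasi-regular, then every other pair `c` with
`(c₀, c₁) = J` is quasi-regular (`IsQuasiRegular.of_span_pair_eq`). Proof: write `c = M c'`, `c' = N c`; the linear forms
`Σ_j (NM − 1)_{kj} X_j` vanish at `c'`, so by quasi-regularity in degree one `NM ≡ 1 (mod J)`, hence `det M` is a unit of the
local ring, `M` is invertible, and `IsQuasiRegular.of_linearSubst` (res-L1-w45b-stub-2's `…NatDirDictAdaptedFrame`) applies.
Written by res-L1-w45b-stub-3 g7. OURS; NOT a statement of any manuscript; AI-written, weaker than expert review. No `sorry`;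
standard axioms; DEF-FREE. `--supports stmt-ResolutionOfSingularities-20148 --as helper`.
[cite: Matsumura1987, §16 Definition p. 124] (index only).
-/

set_option linter.dupNamespace false -- mandated namespace `Summit.<Summit>.<Problem>` of this single-conjunct summit

noncomputable section

open IsLocalRing Literature.AlgebraicGeometry.Resolution

namespace Summit.ResolutionOfSingularities.ResolutionOfSingularities.Cruxes.EquisingularLiftNat.Sections

universe u

variable {R : Type u} [CommRing R]

open MvPolynomial in
/-- The linear form `Σ_j C(a_j) X_j` is homogeneous of degree one. [folklore] -/
theorem isHomogeneous_linearForm (a : Fin 2 → R) :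
    (∑ j, C (a j) * X j : MvPolynomial (Fin 2) R).IsHomogeneous 1 := by
  refine IsHomogeneous.sum _ _ _ fun j _ => ?_
  simpa using (isHomogeneous_C (Fin 2) (a j)).mul (isHomogeneous_X R j)

open MvPolynomial in
/-- Evaluating the linear form `Σ_j C(a_j) X_j`. [folklore] -/
theorem eval_linearForm (a x : Fin 2 → R) :
    eval x (∑ j, C (a j) * X j : MvPolynomial (Fin 2) R) = ∑ j, a j * x j := by
  simp

open MvPolynomial in
/-- The coefficient of `X_j` in the linear form `Σ_j C(a_j) X_j`. [folklore] -/
theorem coeff_linearForm (a : Fin 2 → R) (j : Fin 2) :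
    coeff (Finsupp.single j 1) (∑ j', C (a j') * X j' : MvPolynomial (Fin 2) R) = a j := by
  rw [coeff_sum]
  simp_rw [coeff_C_mul, coeff_X]
  simp only [Finsupp.single_left_inj one_ne_zero, mul_ite, mul_one, mul_zero]
  rw [Finset.sum_ite_eq']
  simp

open MvPolynomial in
/-- Substituting linear forms into a linear form: `(Σ_j C(M_{ij}) X_j)[X_j ↦ Σ_l C(M'_{jl}) X_l] = Σ_l C((M M')_{il}) X_l`.
[folklore] -/
theorem bind₁_linearForm (M M' : Matrix (Fin 2) (Fin 2) R) (i : Fin 2) :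
    bind₁ (fun j => ∑ l, C (M' j l) * X l) (∑ j, C (M i j) * X j : MvPolynomial (Fin 2) R) =
      ∑ l, C ((M * M') i l) * X l := by
  simp only [map_sum, map_mul, bind₁_C_right, bind₁_X_right, Finset.mul_sum, Matrix.mul_apply, map_sum (C : R →+* _),
    Finset.sum_mul]
  rw [Finset.sum_comm]
  refine Finset.sum_congr rfl fun l _ => Finset.sum_congr rfl fun j _ => ?_
  ring

open MvPolynomial in
/-- **Any generating pair of `J ⊆ 𝔪` with a quasi-regular generating pair is quasi-regular** (local ring). See the module
docstring. [cite: Matsumura1987, §16 Definition p. 124] [OURS · L1 W4.5b · C2 B1′] -/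
theorem IsQuasiRegular.of_span_pair_eq [IsLocalRing R] {c c' : Fin 2 → R} (hc' : IsQuasiRegular c')
    (hle : Ideal.span (Set.range c') ≤ maximalIdeal R) (h : Ideal.span (Set.range c) = Ideal.span (Set.range c')) :
    IsQuasiRegular c := by
  classical
  -- `c = M c'`, `c' = N c`
  have hcM : ∀ i, ∃ m : Fin 2 → R, ∑ j, m j * c' j = c i := fun i =>
    Ideal.mem_span_range_iff_exists_fun.mp (h ▸ Ideal.subset_span ⟨i, rfl⟩)
  choose m hm using hcM
  have hcN : ∀ j, ∃ n : Fin 2 → R, ∑ i, n i * c i = c' j := fun j =>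
    Ideal.mem_span_range_iff_exists_fun.mp (h.symm ▸ Ideal.subset_span ⟨j, rfl⟩)
  choose n hn using hcN
  let M : Matrix (Fin 2) (Fin 2) R := Matrix.of fun i j => m i j
  let N : Matrix (Fin 2) (Fin 2) R := Matrix.of fun j i => n j i
  -- `N M ≡ 1 (mod J)` by quasi-regularity in degree one
  have hNM : ∀ k j, (N * M) k j - (1 : Matrix (Fin 2) (Fin 2) R) k j ∈ Ideal.span (Set.range c') := by
    intro k j
    have hF := (isQuasiRegular_def c').mp hc' 1 (∑ j', C ((N * M - 1) k j') * X j') (isHomogeneous_linearForm _) ?_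
      (Finsupp.single j 1)
    · rw [coeff_linearForm] at hF
      simpa only [Matrix.sub_apply] using hF
    · -- the form vanishes at `c'`
      have h0 : eval c' (∑ j', C ((N * M - 1) k j') * X j' : MvPolynomial (Fin 2) R) = 0 := by
        rw [eval_linearForm]
        simp only [Matrix.sub_apply, sub_mul, Finset.sum_sub_distrib, Matrix.one_apply, ite_mul, one_mul, zero_mul,
          Finset.sum_ite_eq, Finset.mem_univ, if_true]
        rw [sub_eq_zero]
        calc ∑ j', (N * M) k j' * c' j' = ∑ j', ∑ i, N k i * M i j' * c' j' := by
              refine Finset.sum_congr rfl fun j' _ => ?_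
              rw [Matrix.mul_apply, Finset.sum_mul]
          _ = ∑ i, N k i * ∑ j', M i j' * c' j' := by
              rw [Finset.sum_comm]
              refine Finset.sum_congr rfl fun i _ => ?_
              rw [Finset.mul_sum]
              refine Finset.sum_congr rfl fun j' _ => ?_
              ring
          _ = ∑ i, n k i * c i := by
              refine Finset.sum_congr rfl fun i _ => ?_
              change n k i * ∑ j', m i j' * c' j' = _
              rw [hm i]
          _ = c' k := hn k
      rw [h0]
      exact Ideal.zero_mem _
  -- hence `det M` is a unit (`N M = 1` in the residue field)
  have hdet : IsUnit M.det := by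
    by_contra hnu
    have hmem : M.det ∈ maximalIdeal R := (mem_maximalIdeal _).mpr hnu
    let π : R →+* ResidueField R := residue R
    have h1 : (N * M).map π = (1 : Matrix (Fin 2) (Fin 2) R).map π := by
      ext k j
      simp only [Matrix.map_apply]
      rw [← sub_eq_zero, ← map_sub, residue_eq_zero_iff]
      exact hle (hNM k j)
    rw [Matrix.map_mul, Matrix.map_one π (map_zero π) (map_one π)] at h1
    have h2 : IsUnit (M.map π).det := by
      have h := congrArg Matrix.det h1
      rw [Matrix.det_mul, Matrix.det_one] at h
      exact IsUnit.of_mul_eq_one_right _ h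
    have h3 : π M.det = (M.map π).det := RingHom.map_det π M
    have h4 : π M.det = 0 := (residue_eq_zero_iff _).mpr hmem
    rw [h3] at h4
    rw [h4] at h2
    exact not_isUnit_zero h2
  -- `M` is invertible: substitute back
  refine IsQuasiRegular.of_linearSubst (x := c') (y := c) (fun i => ∑ j, C (M i j) * X j)
    (fun j => ∑ l, C (M⁻¹ j l) * X l) (fun i => isHomogeneous_linearForm _) (fun i => ?_) (fun i => ?_) h hc'
  · rw [bind₁_linearForm, Matrix.mul_nonsing_inv M hdet]
    simp only [Matrix.one_apply]
    rw [Finset.sum_eq_single i (fun l _ hl => by rw [if_neg (Ne.symm hl), map_zero, zero_mul])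
      (fun hi => absurd (Finset.mem_univ i) hi)]
    rw [if_pos rfl, map_one, one_mul]
  · rw [eval_linearForm]
    exact hm i

end Summit.ResolutionOfSingularities.ResolutionOfSingularities.Cruxes.EquisingularLiftNat.Sections

end
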